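import Mathlib
import HarnessLib
import Literature.Geometry.Riemannian.TwoConvexSchoenfliesProofs
import Summits.ValiantsHypothesis.ValiantsHypothesis.Theorems.KPlusLogSqLawWeakLiftingTowerGraftWronskianKFourAlternating

/-!
# Tower graft line — CONJECTURE W AT `K = 4` PROVED ON THE CONSECUTIVE-SUMSET SUPPORTS `d = (c, c+2, c+3, c+4)`

Helper file for LINE (B) `Cruxes/WeakLifting/Lines/tower_graft.lean` (crux `WeakLifting` = stmt-ValiantsHypothesis-19561), on the located
target (W-4) = `ConjectureWAt 4` of `…WronskianConjectureWDefs` («`Z₊(W(u,v)) ≤ 4` for two real `4`-nomials on a common support»).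
NO stub is claimed; `ConjectureWAt 4` stays OPEN in general.

THE FAMILY.  The supports `d = (c, c+2, c+3, c+4)` (`c ∈ ℕ`) are exactly those in the open cell `d₀ + d₃ < d₁ + d₂` whose six pair sums
`2c+2, …, 2c+7` are CONSECUTIVE, so `X·W(u,v) = X^{2c+2}·Q` with `Q` a genuine quintic whose coefficients are
`(2p₀₁, 3p₀₂, 4p₀₃, p₁₂, 2p₁₃, p₂₃)` (`…KFourAlternating.X_mul_wronskian_four_eq`).  Five distinct positive zeros of `W` make `Q` split
with positive roots `r₁, …, r₅`, and Vieta (Mathlib `Polynomial.coeff_eq_esymm_roots_of_card`) turns the Plücker relation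
`p₀₁p₂₃ − p₀₂p₁₃ + p₀₃p₁₂ = 0`, i.e. `6·a₀a₅ − 2·a₁a₄ + 3·a₂a₃ = 0` for the coefficients `a_k` of `Q`, into
`2·e₁e₄ = 6·e₅ + 3·e₂e₃` for the elementary symmetric functions of the roots — impossible, since for every multiset of non-negative reals
`e₁e₄ ≤ e₂e₃` (a binomial-weight-free Newton inequality, proved here by induction on the multiset together with `e₃ ≤ e₁e₂`, `e₄ ≤ e₂²`)
and `e₅ = r₁⋯r₅ > 0`.

* `esymm_three_le`, `esymm_four_le`, ★ `esymm_one_mul_four_le` — the Newton-type inequalities `e₃ ≤ e₁e₂`, `e₄ ≤ e₂²`, `e₁e₄ ≤ e₂e₃` for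
  multisets of non-negative reals (any size; recursion lemmas from the tree's `Literature.Geometry.Riemannian.esymm_*`);
* ★★ `card_posRoots_wronskian_four_le_four_consecutive` — `Z₊(W(u,v)) ≤ 4` for ALL real `u, v` on the support `(c, c+2, c+3, c+4)`:
  the first complete support family INSIDE the open cell on which Conjecture W at `K = 4` is a theorem (the tree had: `K ≤ 3`, balanced
  `d₀+d₃ = d₁+d₂`, arithmetic `d`, binomial pencils, points off the big Plücker cell).

In the alternant form of (W-4) (`…WronskianKFourAlternant`, this hand) this is the case where the six minors are `e_k(r)·Δ(r)·(monomial)`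
and the alternant inequality has the huge margin `3e₂e₃ + 6e₅ − 2e₁e₄ = 26e₅ + 7m₍₂₁₁₁₎ + 3m₍₂₂₁₎ > 0`; the margin degenerates only
towards the corner `d₁ ≈ d₂ ≈ d₃` (evidence memo of this hand on stmt-19561).

HONEST FRAMING: one 1-parameter family of supports; nothing on S4/S4f/S5/S5ᴸ, TowerB, `WeakLifting`, Conjecture B, `MatrixDescartes` (18050),
`VP ≠ VNP`.  Def-free.  Seat: prover leafhand-val-kpluslogsqlaw-1 g12, `--supports stmt-ValiantsHypothesis-19561 --as helper`.
[folklore: Vieta, Newton's inequalities (weight-free forms); the family theorem is this work]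
-/

-- `Summit.ValiantsHypothesis.ValiantsHypothesis.…` repeats a component by the D-0017 layout
-- (single-conjunct summit), which the `dupNamespace` linter flags; the name is mandated.
set_option linter.dupNamespace false
set_option autoImplicit false

namespace Summit.ValiantsHypothesis.ValiantsHypothesis.Theorems.KPlusLogSqLaw.TowerGraft

open Polynomial Finset
open scoped BigOperators Polynomial
open Literature.Geometry.Riemannian (esymm_zero_eq_one esymm_cons_succ esymm_card_eq_prod esymm_nonneg_of_forall_nonneg
  esymm_eq_zero_of_card_lt)

namespace WronskianDevelopable

/-! ## §1 Weight-free Newton inequalities for multisets of non-negative reals -/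

-- (`e₀ = 1`, the recursion `e_{n+1}(a ∷ s) = e_{n+1}(s) + a·e_n(s)`, `e_n ≥ 0`, `e_{|s|} = ∏ s` are the tree's
-- `Literature.Geometry.Riemannian.esymm_*` lemmas.)

/-- `e₃ ≤ e₁e₂` for multisets of non-negative reals. [folklore: Newton] -/
theorem esymm_three_le (s : Multiset ℝ) (hs : ∀ x ∈ s, 0 ≤ x) : s.esymm 3 ≤ s.esymm 1 * s.esymm 2 := by
  induction s using Multiset.induction_on with
  | empty => simp [esymm_eq_zero_of_card_lt]
  | cons a s ih =>
    have ha : 0 ≤ a := hs a (Multiset.mem_cons_self a s)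
    have hs' : ∀ x ∈ s, 0 ≤ x := fun x hx => hs x (Multiset.mem_cons_of_mem hx)
    have h1 := esymm_nonneg_of_forall_nonneg s hs' 1
    rw [esymm_cons_succ a s 2, esymm_cons_succ a s 1, esymm_cons_succ a s 0, esymm_zero_eq_one]
    nlinarith [ih hs', mul_nonneg ha (mul_self_nonneg (s.esymm 1)), mul_nonneg (mul_self_nonneg a) h1]

/-- `e₄ ≤ e₂²` for multisets of non-negative reals. [folklore: Newton] -/
theorem esymm_four_le (s : Multiset ℝ) (hs : ∀ x ∈ s, 0 ≤ x) : s.esymm 4 ≤ s.esymm 2 * s.esymm 2 := by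
  induction s using Multiset.induction_on with
  | empty => simp [esymm_eq_zero_of_card_lt]
  | cons a s ih =>
    have ha : 0 ≤ a := hs a (Multiset.mem_cons_self a s)
    have hs' : ∀ x ∈ s, 0 ≤ x := fun x hx => hs x (Multiset.mem_cons_of_mem hx)
    have h1 := esymm_nonneg_of_forall_nonneg s hs' 1
    have h2 := esymm_nonneg_of_forall_nonneg s hs' 2
    have h3 := esymm_three_le s hs'
    rw [esymm_cons_succ a s 3, esymm_cons_succ a s 1]
    nlinarith [ih hs', mul_nonneg ha (mul_nonneg h1 h2), mul_nonneg ha (sub_nonneg.mpr h3),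
      mul_nonneg (mul_self_nonneg a) (mul_self_nonneg (s.esymm 1))]

/-- ★ `e₁e₄ ≤ e₂e₃` for multisets of non-negative reals (weight-free Newton inequality). [folklore: Newton] -/
theorem esymm_one_mul_four_le (s : Multiset ℝ) (hs : ∀ x ∈ s, 0 ≤ x) :
    s.esymm 1 * s.esymm 4 ≤ s.esymm 2 * s.esymm 3 := by
  induction s using Multiset.induction_on with
  | empty => simp [esymm_eq_zero_of_card_lt]
  | cons a s ih =>
    have ha : 0 ≤ a := hs a (Multiset.mem_cons_self a s)
    have hs' : ∀ x ∈ s, 0 ≤ x := fun x hx => hs x (Multiset.mem_cons_of_mem hx)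
    have h3 := esymm_three_le s hs'
    have h4 := esymm_four_le s hs'
    rw [esymm_cons_succ a s 3, esymm_cons_succ a s 2, esymm_cons_succ a s 1, esymm_cons_succ a s 0, esymm_zero_eq_one]
    nlinarith [ih hs', mul_nonneg ha (sub_nonneg.mpr h4), mul_nonneg (mul_self_nonneg a) (sub_nonneg.mpr h3)]

/-! ## §2 The family `d = (c, c+2, c+3, c+4)` -/

/-- `X·W(u,v) = X^{2c+2}·Q` with `Q` the quintic `2p₀₁ + 3p₀₂X + 4p₀₃X² + p₁₂X³ + 2p₁₃X⁴ + p₂₃X⁵`. [this work] -/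
theorem X_mul_wronskian_consecutive_eq (u v : Fin 4 → ℝ) (c : ℕ) :
    (X : ℝ[X]) * wronskian (∑ l, C (u l) * (X : ℝ[X]) ^ (![c, c + 2, c + 3, c + 4] : Fin 4 → ℕ) l)
        (∑ l, C (v l) * (X : ℝ[X]) ^ (![c, c + 2, c + 3, c + 4] : Fin 4 → ℕ) l) =
      X ^ (2 * c + 2) *
        (C ((u 0 * v 1 - u 1 * v 0) * 2) + C ((u 0 * v 2 - u 2 * v 0) * 3) * X + C ((u 0 * v 3 - u 3 * v 0) * 4) * X ^ 2 +
          C (u 1 * v 2 - u 2 * v 1) * X ^ 3 + C ((u 1 * v 3 - u 3 * v 1) * 2) * X ^ 4 + C (u 2 * v 3 - u 3 * v 2) * X ^ 5) := by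
  rw [X_mul_wronskian_four_eq]
  simp only [Matrix.cons_val_zero, Matrix.cons_val_one, Matrix.cons_val]
  push_cast
  have e1 : (X : ℝ[X]) ^ (c + (c + 2)) = X ^ (2 * c + 2) := by ring_nf
  have e2 : (X : ℝ[X]) ^ (c + (c + 3)) = X ^ (2 * c + 2) * X := by ring_nf
  have e3 : (X : ℝ[X]) ^ (c + (c + 4)) = X ^ (2 * c + 2) * X ^ 2 := by ring_nf
  have e4 : (X : ℝ[X]) ^ (c + 2 + (c + 3)) = X ^ (2 * c + 2) * X ^ 3 := by ring_nf
  have e5 : (X : ℝ[X]) ^ (c + 2 + (c + 4)) = X ^ (2 * c + 2) * X ^ 4 := by ring_nf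
  have e6 : (X : ℝ[X]) ^ (c + 3 + (c + 4)) = X ^ (2 * c + 2) * X ^ 5 := by ring_nf
  rw [e1, e2, e3, e4, e5, e6]
  have n1 : ((c : ℝ) + 2 - c) = 2 := by ring
  have n2 : ((c : ℝ) + 3 - c) = 3 := by ring
  have n3 : ((c : ℝ) + 4 - c) = 4 := by ring
  have n4 : ((c : ℝ) + 3 - (c + 2)) = 1 := by ring
  have n5 : ((c : ℝ) + 4 - (c + 2)) = 2 := by ring
  have n6 : ((c : ℝ) + 4 - (c + 3)) = 1 := by ring
  rw [n1, n2, n3, n4, n5, n6, mul_one, mul_one]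
  ring

/-- ★★ **CONJECTURE W AT `K = 4` ON THE SUPPORTS `(c, c+2, c+3, c+4)`**: `Z₊(W(u,v)) ≤ 4` for all real `u, v`. [this work] -/
theorem card_posRoots_wronskian_four_le_four_consecutive (u v : Fin 4 → ℝ) (c : ℕ) :
    ((wronskian (∑ l, C (u l) * (X : ℝ[X]) ^ (![c, c + 2, c + 3, c + 4] : Fin 4 → ℕ) l)
        (∑ l, C (v l) * (X : ℝ[X]) ^ (![c, c + 2, c + 3, c + 4] : Fin 4 → ℕ) l)).roots.toFinset.filter
      (fun x => 0 < x)).card ≤ 4 := by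
  classical
  set W : ℝ[X] := wronskian (∑ l, C (u l) * (X : ℝ[X]) ^ (![c, c + 2, c + 3, c + 4] : Fin 4 → ℕ) l)
        (∑ l, C (v l) * (X : ℝ[X]) ^ (![c, c + 2, c + 3, c + 4] : Fin 4 → ℕ) l) with hW
  have hXW := X_mul_wronskian_consecutive_eq u v c
  rw [← hW] at hXW
  -- Plücker coordinates (with the exponent-difference weights) and the quintic
  set q0 := (u 0 * v 1 - u 1 * v 0) * 2 with hq0
  set q1 := (u 0 * v 2 - u 2 * v 0) * 3 with hq1
  set q2 := (u 0 * v 3 - u 3 * v 0) * 4 with hq2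
  set p12 := u 1 * v 2 - u 2 * v 1 with hp12
  set q4 := (u 1 * v 3 - u 3 * v 1) * 2 with hq4
  set p23 := u 2 * v 3 - u 3 * v 2 with hp23def
  set Q : ℝ[X] := C q0 + C q1 * X + C q2 * X ^ 2 + C p12 * X ^ 3 + C q4 * X ^ 4 + C p23 * X ^ 5 with hQ
  by_contra hgt
  have h5 : 5 ≤ (W.roots.toFinset.filter (fun x => 0 < x)).card := by omega
  have hW0 : W ≠ 0 := by
    intro h0; rw [h0, roots_zero] at h5; simp at h5
  have hQ0 : Q ≠ 0 := by
    intro h0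
    rw [h0, mul_zero] at hXW
    exact hW0 ((mul_eq_zero.mp hXW).resolve_left X_ne_zero)
  -- five distinct positive zeros of `W`, all roots of `Q`
  obtain ⟨T, hTS, hT⟩ := Finset.exists_subset_card_eq h5
  have hTpos : ∀ x ∈ T, 0 < x := fun x hx => (Finset.mem_filter.mp (hTS hx)).2
  have hTQ : ∀ x ∈ T, Q.IsRoot x := by
    intro x hx
    have hxW : W.IsRoot x := by
      have h := (Finset.mem_filter.mp (hTS hx)).1
      rw [Multiset.mem_toFinset] at h
      exact (mem_roots hW0).mp h
    have h1 : ((X : ℝ[X]) * W).eval x = 0 := by rw [eval_mul, hxW.eq_zero, mul_zero]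
    rw [hXW, eval_mul, eval_pow, eval_X] at h1
    rcases mul_eq_zero.mp h1 with h | h
    · exact absurd (pow_eq_zero_iff (by omega) |>.mp h) (hTpos x hx).ne'
    · exact h
  have hTle : T.val ≤ Q.roots := by
    rw [Multiset.le_iff_subset T.nodup]
    intro x hx
    exact (mem_roots hQ0).mpr (hTQ x hx)
  -- degree count: `Q` is a quintic with root multiset exactly `T`
  have hdeg5 : Q.natDegree ≤ 5 := by
    rw [hQ]; compute_degree!
  have hcard : Multiset.card Q.roots = 5 ∧ Q.natDegree = 5 := by
    have h1 : 5 ≤ Multiset.card Q.roots := by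
      have := Multiset.card_le_card hTle
      rwa [Finset.card_val, hT] at this
    have h2 := Q.card_roots'
    omega
  have hroots : Q.roots = T.val := (Multiset.eq_of_le_of_card_le hTle (by rw [Finset.card_val, hT, hcard.1])).symm
  have hrc : Multiset.card Q.roots = Q.natDegree := by rw [hcard.1, hcard.2]
  -- Vieta
  set s : Multiset ℝ := T.val with hs
  have hs0 : ∀ x ∈ s, 0 ≤ x := fun x hx => (hTpos x (by simpa [hs] using hx)).le
  have hscard : Multiset.card s = 5 := by rw [hs, Finset.card_val, hT]
  have hL : Q.leadingCoeff = p23 := by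
    rw [Polynomial.leadingCoeff, hcard.2, hQ]
    simp
  have vieta : ∀ k, k ≤ 5 → Q.coeff k = p23 * (-1) ^ (5 - k) * s.esymm (5 - k) := by
    intro k hk
    have := Polynomial.coeff_eq_esymm_roots_of_card hrc (k := k) (by rw [hcard.2]; exact hk)
    rw [hL, hcard.2, hroots] at this
    exact this
  have a0 : q0 = p23 * (-1) ^ 5 * s.esymm 5 := by
    have := vieta 0 (by norm_num); rw [hQ] at this; simpa using this
  have a1 : q1 = p23 * (-1) ^ 4 * s.esymm 4 := by
    have := vieta 1 (by norm_num); rw [hQ] at this; simpa using this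
  have a2 : q2 = p23 * (-1) ^ 3 * s.esymm 3 := by
    have := vieta 2 (by norm_num); rw [hQ] at this; simpa using this
  have a3 : p12 = p23 * (-1) ^ 2 * s.esymm 2 := by
    have := vieta 3 (by norm_num); rw [hQ] at this; simpa using this
  have a4 : q4 = p23 * (-1) ^ 1 * s.esymm 1 := by
    have := vieta 4 (by norm_num); rw [hQ] at this; simpa [coeff_X] using this
  -- the Plücker relation `p₀₁p₂₃ − p₀₂p₁₃ + p₀₃p₁₂ = 0`, times `12`
  have plucker : 6 * q0 * p23 - 2 * q1 * q4 + 3 * q2 * p12 = 0 := by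
    rw [hq0, hq1, hq2, hp12, hq4, hp23def]; ring
  rw [a0, a1, a2, a3, a4] at plucker
  -- `p₂₃ ≠ 0` (leading coefficient of the quintic)
  have hp23 : p23 ≠ 0 := by rw [← hL]; exact leadingCoeff_ne_zero.mpr hQ0
  have hsq : 0 < p23 ^ 2 := by positivity
  -- symmetric-function inequalities
  have e14 := esymm_one_mul_four_le s hs0
  have e2 := esymm_nonneg_of_forall_nonneg s hs0 2
  have e3 := esymm_nonneg_of_forall_nonneg s hs0 3
  have e5 : 0 < s.esymm 5 := by
    rw [← hscard, esymm_card_eq_prod, hs]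
    rw [Finset.prod_val]   -- `T.val.prod = ∏ x ∈ T, x`
    exact Finset.prod_pos fun x hx => hTpos x hx
  nlinarith [mul_nonneg e2 e3, mul_pos hsq e5, mul_nonneg hsq.le (sub_nonneg.mpr e14), mul_nonneg hsq.le (mul_nonneg e2 e3)]

end WronskianDevelopable

end Summit.ValiantsHypothesis.ValiantsHypothesis.Theorems.KPlusLogSqLaw.TowerGraft
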